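import Summits.QuantumFields.YangMills.Theorems.FemtoCurvatureSkewness.Negative.ZeroCoupling
import Summits.QuantumFields.YangMills.Theorems.FemtoCurvatureSkewness.Negative.WeakCoupling
import Literature.MathematicalPhysics.QuantumFieldTheory.CurvatureGaussianField
import Literature.MathematicalPhysics.QuantumLattice.LatticeGaugeDLR

/-!
# Sketch (crux-ideate g2, ideator 1, round 1) — first lemmas of the two idea cards
`coupling-cubic-response` and `dirichlet-window-skewness` for crux `stmt-QuantumFields-9365`
(`LangevinControlUV.FemtoCurvatureSkewness`).

Everything here is a STATEMENT over existing declarations (it must elaborate; proofs are not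
claimed unless given).  `sorry` marks statements to be proved by the line; the glue lemmas at the
end (`artefactLayer_of_small_large`, `skewness_on_artefact_layer`) are proved.

Vocabulary reused from the landed negative files of this crux
(`Theorems/FemtoCurvatureSkewness/Negative/*`): `plaq`, `wE`, `wCov`, `kappa3` (the crux's typed
third cumulant of `(P_0^{01}, P_{ne₂}^{01}, P_{ne₃}^{01})`), `TwoPointPackage`, `SkewnessPackage`.
-/

noncomputable section

namespace Summit.QuantumFields.YangMills.Cruxes.FemtoCurvatureSkewness.SketchG2I1

open MeasureTheory Filter Topology Matrix
open Literature.MathematicalPhysics.QuantumFieldTheory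
open Summit.QuantumFields.YangMills.Theorems.ContinuumLimitOnTrajectory.Negative (piHaar)
open Summit.QuantumFields.YangMills.Theorems.FemtoCurvatureSkewness.Negative
  (plaq wE wCov kappa3 TwoPointPackage SkewnessPackage continuous_plaq plaq_nonneg plaq_le)

/-! ## Part A — card `coupling-cubic-response`

`P_p = N − Re tr r(U_p)` is the variable conjugate to the coupling of the plaquette `p`, so with
three MARKED plaquette couplings `β + t₀, β + t₂, β + t₃` at the corner `p₀ = (0;0,1)` and the two
arms `p₂ = (ne₂;0,1)`, `p₃ = (ne₃;0,1)`:
  `κ₃(P₀,P₂,P₃) = −∂³ log Z_L(β; t₀,t₂,t₃)/∂t₀∂t₂∂t₃ |_{t=0}`  (exact, every `L`, `β`, compact `G`).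
-/

section CouplingResponse

variable {G : Type} [Group G] [TopologicalSpace G] [IsTopologicalGroup G] [CompactSpace G]
  [MeasurableSpace G] [BorelSpace G]

/-- The arm site `n e₂`. -/
def siteY (L n : ℕ) : Site 4 L := Pi.single (2 : Fin 4) ((n : ℕ) : ZMod L)

/-- The arm site `n e₃`. -/
def siteZ (L n : ℕ) : Site 4 L := Pi.single (3 : Fin 4) ((n : ℕ) : ZMod L)

/-- Source-extended torus partition function: Wilson weight with the couplings of the three marked
plaquettes shifted by `t₀, t₂, t₃` (real sources). -/
def Zsrc (r : LatticeRep G) (L : ℕ) [NeZero L] (β : ℝ) (n : ℕ) (t₀ t₂ t₃ : ℝ) : ℝ :=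
  ∫ U, Real.exp (-β * wilsonAction (d := 4) (L := L) r.ρ U
      - t₀ * plaq r L 0 0 1 U - t₂ * plaq r L (siteY L n) 0 1 U - t₃ * plaq r L (siteZ L n) 0 1 U)
    ∂piHaar L

/-- **First lemma A1 (provable now; finite-dimensional calculus on the compact configuration space):**
the crux's third cumulant is minus the third mixed derivative of the log of the source-extended
partition function at zero sources. -/
theorem kappa3_eq_neg_deriv3_log_Zsrc (r : LatticeRep G) (L : ℕ) [NeZero L] (β : ℝ) (n : ℕ) :
    deriv (fun t₀ : ℝ => deriv (fun t₂ : ℝ => deriv (fun t₃ : ℝ =>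
        Real.log (Zsrc r L β n t₀ t₂ t₃)) 0) 0) 0 = - kappa3 r L β n := by
  sorry

/-- Complex sources: the same integral with `t : Fin 3 → ℂ`. -/
def ZsrcC (r : LatticeRep G) (L : ℕ) [NeZero L] (β : ℝ) (n : ℕ) (t : Fin 3 → ℂ) : ℂ :=
  ∫ U, Complex.exp (-((β * wilsonAction (d := 4) (L := L) r.ρ U : ℝ) : ℂ)
      - t 0 * (plaq r L 0 0 1 U : ℂ) - t 1 * (plaq r L (siteY L n) 0 1 U : ℂ)
      - t 2 * (plaq r L (siteZ L n) 0 1 U : ℂ)) ∂piHaar L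

/-- **First lemma A2 (provable now): a UNIFORM analyticity polydisc in the marked couplings.**
Because `0 ≤ P ≤ 2N`, for `‖t_i‖ < π/(12 N)` the phase of the integrand stays in `(−π/2, π/2)`,
so `Re Z_L(β; t) > 0` — for EVERY torus `L`, every real `β`, every compact `G` (PROVED below): the connected
pressure `log Z_L(β; ·)` is holomorphic on a polydisc of radius independent of `(L, β)`, and
`κ₃ = −(2πi)⁻³ ∮∮∮ log Z dt/(t₀²t₂²t₃²)` (Cauchy) is a contour average of it. -/
theorem ZsrcC_re_pos (r : LatticeRep G) (L : ℕ) [NeZero L] (β : ℝ) (n : ℕ)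
    (t : Fin 3 → ℂ) (ht : ∀ i, ‖t i‖ < Real.pi / (12 * r.N)) : 0 < (ZsrcC r L β n t).re := by
  classical
  haveI : SecondCountableTopology G :=
    (r.continuous.isClosedEmbedding r.injective).isEmbedding.secondCountableTopology
  -- `N ≥ 1`, else the hypothesis is void
  have hN : 0 < (r.N : ℝ) := by
    by_contra h
    have h0 : (r.N : ℝ) = 0 := le_antisymm (not_lt.1 h) (Nat.cast_nonneg _)
    have := ht 0
    rw [h0, mul_zero, div_zero] at this
    exact absurd this (not_lt.2 (norm_nonneg _))
  -- the exponent and its continuity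
  set w : GaugeConfig 4 L G → ℂ := fun U => -((β * wilsonAction (d := 4) (L := L) r.ρ U : ℝ) : ℂ)
      - t 0 * (plaq r L 0 0 1 U : ℂ) - t 1 * (plaq r L (siteY L n) 0 1 U : ℂ)
      - t 2 * (plaq r L (siteZ L n) 0 1 U : ℂ) with hw
  have hS : Continuous (wilsonAction (d := 4) (L := L) r.ρ : GaugeConfig 4 L G → ℝ) :=
    Literature.Barriers.QuantumFields.Elitzur.continuous_wilsonAction r.ρ r.continuous
  have hP : ∀ x : Site 4 L, Continuous (plaq r L x 0 1 : GaugeConfig 4 L G → ℝ) :=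
    fun x => continuous_plaq r L x 0 1
  have hwc : Continuous w := by
    have h1 : Continuous fun U : GaugeConfig 4 L G =>
        ((β * wilsonAction (d := 4) (L := L) r.ρ U : ℝ) : ℂ) :=
      Complex.continuous_ofReal.comp (continuous_const.mul hS)
    have h2 : ∀ x : Site 4 L, Continuous fun U : GaugeConfig 4 L G => (plaq r L x 0 1 U : ℂ) :=
      fun x => Complex.continuous_ofReal.comp (hP x)
    exact ((h1.neg.sub (continuous_const.mul (h2 0))).sub (continuous_const.mul (h2 _))).sub
      (continuous_const.mul (h2 _))
  have hfc : Continuous fun U => Complex.exp (w U) := Complex.continuous_exp.comp hwc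
  have hfi : Integrable (fun U => Complex.exp (w U)) (piHaar L) :=
    hfc.integrable_of_hasCompactSupport (HasCompactSupport.of_compactSpace _)
  -- pointwise: the imaginary part of the exponent stays in (-π/2, π/2)
  have hbound : ∀ (i : Fin 3) (x : Site 4 L) (U : GaugeConfig 4 L G),
      |(t i).im * plaq r L x 0 1 U| ≤ ‖t i‖ * (2 * r.N) := fun i x U => by
    rw [abs_mul, abs_of_nonneg (plaq_nonneg r L x 0 1 U)]
    exact mul_le_mul (Complex.abs_im_le_norm _) (plaq_le r L x 0 1 U) (plaq_nonneg r L x 0 1 U)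
      (norm_nonneg _)
  have him : ∀ U, |(w U).im| < Real.pi / 2 := fun U => by
    have hwim : (w U).im = -((t 0).im * plaq r L 0 0 1 U) - (t 1).im * plaq r L (siteY L n) 0 1 U
        - (t 2).im * plaq r L (siteZ L n) 0 1 U := by
      simp [hw, Complex.mul_im]
    rw [hwim]
    have h0 := hbound 0 0 U
    have h1 := hbound 1 (siteY L n) U
    have h2 := hbound 2 (siteZ L n) U
    have ht' : ∀ i, ‖t i‖ * (2 * r.N) < Real.pi / 6 := fun i => by
      have := mul_lt_mul_of_pos_right (ht i) (by positivity : (0 : ℝ) < 2 * r.N)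
      calc ‖t i‖ * (2 * r.N) < Real.pi / (12 * r.N) * (2 * r.N) := this
        _ = Real.pi / 6 := by field_simp; ring
    have key : |-((t 0).im * plaq r L 0 0 1 U) - (t 1).im * plaq r L (siteY L n) 0 1 U
        - (t 2).im * plaq r L (siteZ L n) 0 1 U|
        ≤ |(t 0).im * plaq r L 0 0 1 U| + |(t 1).im * plaq r L (siteY L n) 0 1 U|
          + |(t 2).im * plaq r L (siteZ L n) 0 1 U| := by
      have a1 := abs_sub (-((t 0).im * plaq r L 0 0 1 U) - (t 1).im * plaq r L (siteY L n) 0 1 U)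
        ((t 2).im * plaq r L (siteZ L n) 0 1 U)
      have a2 := abs_sub (-((t 0).im * plaq r L 0 0 1 U)) ((t 1).im * plaq r L (siteY L n) 0 1 U)
      rw [abs_neg] at a2
      linarith
    linarith [ht' 0, ht' 1, ht' 2]
  have hpos : ∀ U, 0 < (Complex.exp (w U)).re := fun U => by
    rw [Complex.exp_re]
    have hh := abs_lt.1 (him U)
    exact mul_pos (Real.exp_pos _) (Real.cos_pos_of_mem_Ioo ⟨by linarith [hh.1], by linarith [hh.2]⟩)
  -- real part of the integral = integral of the real part
  have hre : (ZsrcC r L β n t).re = ∫ U, (Complex.exp (w U)).re ∂piHaar L := by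
    have key := Complex.reCLM.integral_comp_comm hfi
    simp only [Complex.reCLM_apply] at key
    rw [key]
    rfl
  rw [hre]
  have hgi : Integrable (fun U => (Complex.exp (w U)).re) (piHaar L) := hfi.re
  rw [integral_pos_iff_support_of_nonneg (fun U => (hpos U).le) hgi]
  have hsupp : Function.support (fun U => (Complex.exp (w U)).re) = Set.univ := by
    ext U
    simp only [Function.mem_support, ne_eq, Set.mem_univ, iff_true]
    exact (hpos U).ne'
  rw [hsupp, measure_univ]
  exact one_pos

/-- **First lemma A3 (provable now, linear algebra): the sign carrier.**  Third mixed derivative of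
`log det` of a positive-definite matrix perturbed by three symmetric "stiffness insertions":
`∂³ log det(A + Σ tᵢQᵢ)|₀ = 2 tr(A⁻¹Q₀A⁻¹Q₂A⁻¹Q₃)`.  For the one-loop effective action
`W = −½ log det` this gives `κ₃^{1-loop} = −∂³(−½ log det) = tr(CQ₀CQ₂CQ₃)`, `C = A⁻¹`; with rank-one
insertions `Qᵢ = qᵢqᵢᵀ` it is the permanental triangle `(q₀ᵀCq₂)(q₂ᵀCq₃)(q₃ᵀCq₀)`. -/
theorem deriv3_log_det {m : ℕ} (A Q₀ Q₂ Q₃ : Matrix (Fin m) (Fin m) ℝ) (hA : A.PosDef)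
    (h₀ : Q₀.IsSymm) (h₂ : Q₂.IsSymm) (h₃ : Q₃.IsSymm) :
    deriv (fun t₀ : ℝ => deriv (fun t₂ : ℝ => deriv (fun t₃ : ℝ =>
        Real.log ((A + t₀ • Q₀ + t₂ • Q₂ + t₃ • Q₃).det)) 0) 0) 0
      = 2 * (A⁻¹ * Q₀ * A⁻¹ * Q₂ * A⁻¹ * Q₃).trace := by
  sorry

end CouplingResponse

/-! ### Tree-level sign, for ALL separations and (via the torus analogue) all volumes:
the transverse curvature propagator is a positive mixture of 2-d Yukawa kernels.

For the lattice Maxwell field strength on `ℤ⁴` (tree `curvatureGaussianField`, kernel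
`curvatureTwoPoint`), the (1,2)-plaquette two-point function at a displacement `x` TRANSVERSE to the
(1,2)-plane (`x₁ = x₂ = 0`) is, in momentum space, `(k̂₁² + k̂₂²)/k̂²`; slicing in `(k₁,k₂)` gives
`G(0,0,x₀,x₃) = ∫dk₁dk₂/(2π)² · m²(k₁,k₂) · G^{2d}_{m²}(x₀,x₃)` with `m² = k̂₁² + k̂₂² ≥ 0` and
`G^{2d}_{m²}` the (strictly positive: random walk with killing) two-dimensional lattice Yukawa
kernel.  Hence `G > 0` at EVERY transverse displacement, in particular on both legs `ne₀`, `ne₃`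
and on the hypotenuse `n(e₀ − e₃)` of the crux's triangle — no numerics, no restriction on `n`. -/

section TransversePositivity

open Literature.Probability.LatticeModels (Site)

/-- **First lemma A4 / B0 (provable now): transverse positivity of the curvature propagator.** -/
theorem curvatureTwoPoint_transverse_pos (x : Site 4) (hx1 : x ⟨1, by norm_num⟩ = 0)
    (hx2 : x ⟨2, by norm_num⟩ = 0) :
    0 < curvatureTwoPoint (plaquette12 (d := 4) (by norm_num) 0)
      (plaquette12 (d := 4) (by norm_num) x) := by
  sorry

/-- In particular the axis numbers `c_n` of the tree are all strictly positive. -/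
theorem curvaturePlaquetteCorr_pos (n : ℤ) : 0 < curvaturePlaquetteCorr (d := 4) (by norm_num) n := by
  sorry

/-- **Tree-level triangle is positive for every `n`** (product of three transverse kernels:
legs `n e₀`, `n e₃`, hypotenuse `n e₀ − n e₃`; stationarity `curvatureTwoPoint_shift` moves the
third kernel to the origin). -/
theorem treeTriangle_pos (n : ℤ) :
    0 < curvatureTwoPoint (plaquette12 (d := 4) (by norm_num) 0)
          (plaquette12 (d := 4) (by norm_num) (Pi.single ⟨0, by norm_num⟩ n)) *
        curvatureTwoPoint (plaquette12 (d := 4) (by norm_num) 0)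
          (plaquette12 (d := 4) (by norm_num) (Pi.single ⟨3, by norm_num⟩ n)) *
        curvatureTwoPoint (plaquette12 (d := 4) (by norm_num) 0)
          (plaquette12 (d := 4) (by norm_num)
            (Pi.single ⟨0, by norm_num⟩ n - Pi.single ⟨3, by norm_num⟩ n)) := by
  refine mul_pos (mul_pos ?_ ?_) ?_
  · exact curvatureTwoPoint_transverse_pos _ (by simp) (by simp)
  · exact curvatureTwoPoint_transverse_pos _ (by simp) (by simp)
  · exact curvatureTwoPoint_transverse_pos _ (by simp) (by simp)

end TransversePositivity

/-! ## Part B — card `dirichlet-window-skewness`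

Total cumulance with respect to the σ-algebra of the links OUTSIDE a window around the triangle
(spatial Markov / DLR), an inner Dirichlet Laplace lemma for the conditional skewness (sign-safe:
background dressings are non-negative), and the equipartition budget for the cross terms. -/

section TotalCumulance

variable {Ω : Type*}

/-! Definitions with the Mathlib binder convention: the sub-σ-algebra `m` is bound BEFORE the
ambient `mΩ`, so `Measure Ω`, `Measurable`, `∫` refer to `mΩ` and `μ[·|m]` conditions on `m`. -/

def cum3 {mΩ : MeasurableSpace Ω} (μ : Measure Ω) (X Y Z : Ω → ℝ) : ℝ :=
  ∫ ω, (X ω - ∫ a, X a ∂μ) * (Y ω - ∫ a, Y a ∂μ) * (Z ω - ∫ a, Z a ∂μ) ∂μ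

def condCov (m : MeasurableSpace Ω) {mΩ : MeasurableSpace Ω} (μ : Measure Ω) (Y Z : Ω → ℝ) :
    Ω → ℝ :=
  fun ω => (μ[fun a => Y a * Z a|m]) ω - (μ[Y|m]) ω * (μ[Z|m]) ω

def condCum3 (m : MeasurableSpace Ω) {mΩ : MeasurableSpace Ω} (μ : Measure Ω) (X Y Z : Ω → ℝ) :
    Ω → ℝ :=
  fun ω => (μ[fun a => X a * Y a * Z a|m]) ω
    - (μ[X|m]) ω * condCov m μ Y Z ω - (μ[Y|m]) ω * condCov m μ X Z ω
    - (μ[Z|m]) ω * condCov m μ X Y ω - (μ[X|m]) ω * (μ[Y|m]) ω * (μ[Z|m]) ω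

/-- **First lemma B1 (Brillinger 1969, law of total cumulance at order 3) — PROVED.**
`κ₃(X,Y,Z) = E κ₃(X,Y,Z | m) + Σ_{3} Cov(E[X|m], Cov(Y,Z|m)) + κ₃(E[X|m], E[Y|m], E[Z|m])`
for bounded measurable `X, Y, Z`, a probability measure and any sub-σ-algebra `m ≤ mΩ`
(the three terms with exactly one conditioned factor vanish by the tower property; the proof
reduces the merged right-hand side to a linear combination of conditional expectations and uses
`integral_condExp`). -/
theorem total_cumulance3 {m mΩ : MeasurableSpace Ω} (hm : m ≤ mΩ) (μ : Measure Ω)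
    [IsProbabilityMeasure μ] {X Y Z : Ω → ℝ} (hX : Measurable X) (hY : Measurable Y)
    (hZ : Measurable Z) (hb : ∃ M : ℝ, ∀ ω, |X ω| ≤ M ∧ |Y ω| ≤ M ∧ |Z ω| ≤ M) :
    cum3 μ X Y Z =
      (∫ ω, condCum3 m μ X Y Z ω ∂μ)
      + (∫ ω, ((μ[X|m]) ω - ∫ a, X a ∂μ) * condCov m μ Y Z ω ∂μ)
      + (∫ ω, ((μ[Y|m]) ω - ∫ a, Y a ∂μ) * condCov m μ X Z ω ∂μ)
      + (∫ ω, ((μ[Z|m]) ω - ∫ a, Z a ∂μ) * condCov m μ X Y ω ∂μ)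
      + ∫ ω, ((μ[X|m]) ω - ∫ a, X a ∂μ) * ((μ[Y|m]) ω - ∫ a, Y a ∂μ)
          * ((μ[Z|m]) ω - ∫ a, Z a ∂μ) ∂μ := by
  obtain ⟨M, hM⟩ := hb
  set K : ℝ := max M 1 with hKdef
  have hK0 : 0 ≤ K := le_trans zero_le_one (le_max_right _ _)
  have bX : ∀ ω, |X ω| ≤ K := fun ω => (hM ω).1.trans (le_max_left _ _)
  have bY : ∀ ω, |Y ω| ≤ K := fun ω => (hM ω).2.1.trans (le_max_left _ _)
  have bZ : ∀ ω, |Z ω| ≤ K := fun ω => (hM ω).2.2.trans (le_max_left _ _)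
  -- integrability of bounded measurable functions
  have hint : ∀ (f : Ω → ℝ) (C : ℝ), Measurable f → (∀ ω, |f ω| ≤ C) → Integrable f μ :=
    fun f C hf hC => Integrable.of_bound hf.aestronglyMeasurable C
      (Filter.Eventually.of_forall fun ω => by rw [Real.norm_eq_abs]; exact hC ω)
  have bXY : ∀ ω, |X ω * Y ω| ≤ K * K := fun ω => by
    rw [abs_mul]; exact mul_le_mul (bX ω) (bY ω) (abs_nonneg _) hK0
  have bXZ : ∀ ω, |X ω * Z ω| ≤ K * K := fun ω => by
    rw [abs_mul]; exact mul_le_mul (bX ω) (bZ ω) (abs_nonneg _) hK0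
  have bYZ : ∀ ω, |Y ω * Z ω| ≤ K * K := fun ω => by
    rw [abs_mul]; exact mul_le_mul (bY ω) (bZ ω) (abs_nonneg _) hK0
  have bXYZ : ∀ ω, |X ω * Y ω * Z ω| ≤ K * K * K := fun ω => by
    rw [abs_mul]; exact mul_le_mul (bXY ω) (bZ ω) (abs_nonneg _) (mul_nonneg hK0 hK0)
  have iX : Integrable X μ := hint X K hX bX
  have iY : Integrable Y μ := hint Y K hY bY
  have iZ : Integrable Z μ := hint Z K hZ bZ
  have iXY : Integrable (fun ω => X ω * Y ω) μ := hint _ _ (hX.mul hY) bXY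
  have iXZ : Integrable (fun ω => X ω * Z ω) μ := hint _ _ (hX.mul hZ) bXZ
  have iYZ : Integrable (fun ω => Y ω * Z ω) μ := hint _ _ (hY.mul hZ) bYZ
  have iXYZ : Integrable (fun ω => X ω * Y ω * Z ω) μ := hint _ _ ((hX.mul hY).mul hZ) bXYZ
  -- conditional expectations: integrable, measurable, bounded a.e.
  have iXh : Integrable (μ[X|m]) μ := integrable_condExp
  have iYh : Integrable (μ[Y|m]) μ := integrable_condExp
  have iZh : Integrable (μ[Z|m]) μ := integrable_condExp
  have iWxy : Integrable (μ[fun a => X a * Y a|m]) μ := integrable_condExp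
  have iWxz : Integrable (μ[fun a => X a * Z a|m]) μ := integrable_condExp
  have iWyz : Integrable (μ[fun a => Y a * Z a|m]) μ := integrable_condExp
  have iWxyz : Integrable (μ[fun a => X a * Y a * Z a|m]) μ := integrable_condExp
  have mXh : AEStronglyMeasurable (μ[X|m]) μ := iXh.aestronglyMeasurable
  have mYh : AEStronglyMeasurable (μ[Y|m]) μ := iYh.aestronglyMeasurable
  have mZh : AEStronglyMeasurable (μ[Z|m]) μ := iZh.aestronglyMeasurable
  have aX : ∀ᵐ ω ∂μ, |(μ[X|m]) ω| ≤ K :=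
    ae_bdd_abs_condExp_of_ae_bdd_abs (Filter.Eventually.of_forall bX)
  have aY : ∀ᵐ ω ∂μ, |(μ[Y|m]) ω| ≤ K :=
    ae_bdd_abs_condExp_of_ae_bdd_abs (Filter.Eventually.of_forall bY)
  have aZ : ∀ᵐ ω ∂μ, |(μ[Z|m]) ω| ≤ K :=
    ae_bdd_abs_condExp_of_ae_bdd_abs (Filter.Eventually.of_forall bZ)
  -- norms instead of abs
  have nX : ∀ᵐ ω ∂μ, ‖(μ[X|m]) ω‖ ≤ K := aX.mono fun ω h => by rwa [Real.norm_eq_abs]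
  have nY : ∀ᵐ ω ∂μ, ‖(μ[Y|m]) ω‖ ≤ K := aY.mono fun ω h => by rwa [Real.norm_eq_abs]
  have nZ : ∀ᵐ ω ∂μ, ‖(μ[Z|m]) ω‖ ≤ K := aZ.mono fun ω h => by rwa [Real.norm_eq_abs]
  have nXa : ∀ᵐ ω ∂μ, ‖(μ[X|m]) ω - ∫ a, X a ∂μ‖ ≤ K + ‖∫ a, X a ∂μ‖ :=
    nX.mono fun ω h => (norm_sub_le _ _).trans (by linarith)
  have nYb : ∀ᵐ ω ∂μ, ‖(μ[Y|m]) ω - ∫ a, Y a ∂μ‖ ≤ K + ‖∫ a, Y a ∂μ‖ :=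
    nY.mono fun ω h => (norm_sub_le _ _).trans (by linarith)
  have nZc : ∀ᵐ ω ∂μ, ‖(μ[Z|m]) ω - ∫ a, Z a ∂μ‖ ≤ K + ‖∫ a, Z a ∂μ‖ :=
    nZ.mono fun ω h => (norm_sub_le _ _).trans (by linarith)
  have nXY : ∀ᵐ ω ∂μ, ‖(μ[X|m]) ω * (μ[Y|m]) ω‖ ≤ K * K := by
    filter_upwards [nX, nY] with ω h1 h2
    rw [norm_mul]; exact mul_le_mul h1 h2 (norm_nonneg _) hK0
  have nXaYb : ∀ᵐ ω ∂μ, ‖((μ[X|m]) ω - ∫ a, X a ∂μ) * ((μ[Y|m]) ω - ∫ a, Y a ∂μ)‖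
      ≤ (K + ‖∫ a, X a ∂μ‖) * (K + ‖∫ a, Y a ∂μ‖) := by
    filter_upwards [nXa, nYb] with ω h1 h2
    rw [norm_mul]
    exact mul_le_mul h1 h2 (norm_nonneg _) (by positivity)
  -- products
  have iYhZh : Integrable (fun ω => (μ[Y|m]) ω * (μ[Z|m]) ω) μ := iZh.bdd_mul mYh nY
  have iXhZh : Integrable (fun ω => (μ[X|m]) ω * (μ[Z|m]) ω) μ := iZh.bdd_mul mXh nX
  have iXhYh : Integrable (fun ω => (μ[X|m]) ω * (μ[Y|m]) ω) μ := iYh.bdd_mul mXh nX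
  have iCyz : Integrable (condCov m μ Y Z) μ := iWyz.sub iYhZh
  have iCxz : Integrable (condCov m μ X Z) μ := iWxz.sub iXhZh
  have iCxy : Integrable (condCov m μ X Y) μ := iWxy.sub iXhYh
  have iXhYhZh : Integrable (fun ω => (μ[X|m]) ω * (μ[Y|m]) ω * (μ[Z|m]) ω) μ :=
    iZh.bdd_mul (mXh.mul mYh) nXY
  have i1 : Integrable (fun ω => condCum3 m μ X Y Z ω) μ := by
    have h1 : Integrable (fun ω => (μ[X|m]) ω * condCov m μ Y Z ω) μ := iCyz.bdd_mul mXh nX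
    have h2 : Integrable (fun ω => (μ[Y|m]) ω * condCov m μ X Z ω) μ := iCxz.bdd_mul mYh nY
    have h3 : Integrable (fun ω => (μ[Z|m]) ω * condCov m μ X Y ω) μ := iCxy.bdd_mul mZh nZ
    exact (((iWxyz.sub h1).sub h2).sub h3).sub iXhYhZh
  have i2 : Integrable (fun ω => ((μ[X|m]) ω - ∫ a, X a ∂μ) * condCov m μ Y Z ω) μ :=
    iCyz.bdd_mul (mXh.sub aestronglyMeasurable_const) nXa
  have i3 : Integrable (fun ω => ((μ[Y|m]) ω - ∫ a, Y a ∂μ) * condCov m μ X Z ω) μ :=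
    iCxz.bdd_mul (mYh.sub aestronglyMeasurable_const) nYb
  have i4 : Integrable (fun ω => ((μ[Z|m]) ω - ∫ a, Z a ∂μ) * condCov m μ X Y ω) μ :=
    iCxy.bdd_mul (mZh.sub aestronglyMeasurable_const) nZc
  have i5 : Integrable (fun ω => ((μ[X|m]) ω - ∫ a, X a ∂μ) * ((μ[Y|m]) ω - ∫ a, Y a ∂μ)
      * ((μ[Z|m]) ω - ∫ a, Z a ∂μ)) μ :=
    (iZh.sub (integrable_const _)).bdd_mul
      ((mXh.sub aestronglyMeasurable_const).mul (mYh.sub aestronglyMeasurable_const)) nXaYb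
  -- Step 1: merge the five integrals
  have i12 : Integrable (fun ω => condCum3 m μ X Y Z ω
      + ((μ[X|m]) ω - ∫ a, X a ∂μ) * condCov m μ Y Z ω) μ := i1.add i2
  have i123 : Integrable (fun ω => condCum3 m μ X Y Z ω
      + ((μ[X|m]) ω - ∫ a, X a ∂μ) * condCov m μ Y Z ω
      + ((μ[Y|m]) ω - ∫ a, Y a ∂μ) * condCov m μ X Z ω) μ := i12.add i3
  have i1234 : Integrable (fun ω => condCum3 m μ X Y Z ω
      + ((μ[X|m]) ω - ∫ a, X a ∂μ) * condCov m μ Y Z ω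
      + ((μ[Y|m]) ω - ∫ a, Y a ∂μ) * condCov m μ X Z ω
      + ((μ[Z|m]) ω - ∫ a, Z a ∂μ) * condCov m μ X Y ω) μ := i123.add i4
  rw [← integral_add i1 i2, ← integral_add i12 i3, ← integral_add i123 i4, ← integral_add i1234 i5]
  -- Step 2: the merged integrand is a LINEAR combination of conditional expectations
  have hlin : ∀ ω, condCum3 m μ X Y Z ω + ((μ[X|m]) ω - ∫ a, X a ∂μ) * condCov m μ Y Z ω
      + ((μ[Y|m]) ω - ∫ a, Y a ∂μ) * condCov m μ X Z ω
      + ((μ[Z|m]) ω - ∫ a, Z a ∂μ) * condCov m μ X Y ω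
      + ((μ[X|m]) ω - ∫ a, X a ∂μ) * ((μ[Y|m]) ω - ∫ a, Y a ∂μ) * ((μ[Z|m]) ω - ∫ a, Z a ∂μ)
      = (μ[fun a => X a * Y a * Z a|m]) ω - (∫ a, X a ∂μ) * (μ[fun a => Y a * Z a|m]) ω
        - (∫ a, Y a ∂μ) * (μ[fun a => X a * Z a|m]) ω
        - (∫ a, Z a ∂μ) * (μ[fun a => X a * Y a|m]) ω
        + (∫ a, X a ∂μ) * (∫ a, Y a ∂μ) * (μ[Z|m]) ω
        + (∫ a, X a ∂μ) * (∫ a, Z a ∂μ) * (μ[Y|m]) ω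
        + (∫ a, Y a ∂μ) * (∫ a, Z a ∂μ) * (μ[X|m]) ω
        - (∫ a, X a ∂μ) * (∫ a, Y a ∂μ) * (∫ a, Z a ∂μ) := fun ω => by
    simp only [condCum3, condCov]
    ring
  simp_rw [hlin]
  -- Step 3: integrate the linear combination termwise
  have g1 : Integrable (fun ω => (μ[fun a => X a * Y a * Z a|m]) ω
      - (∫ a, X a ∂μ) * (μ[fun a => Y a * Z a|m]) ω) μ := iWxyz.sub (iWyz.const_mul _)
  have g2 : Integrable (fun ω => (μ[fun a => X a * Y a * Z a|m]) ω
      - (∫ a, X a ∂μ) * (μ[fun a => Y a * Z a|m]) ω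
      - (∫ a, Y a ∂μ) * (μ[fun a => X a * Z a|m]) ω) μ := g1.sub (iWxz.const_mul _)
  have g3 : Integrable (fun ω => (μ[fun a => X a * Y a * Z a|m]) ω
      - (∫ a, X a ∂μ) * (μ[fun a => Y a * Z a|m]) ω
      - (∫ a, Y a ∂μ) * (μ[fun a => X a * Z a|m]) ω
      - (∫ a, Z a ∂μ) * (μ[fun a => X a * Y a|m]) ω) μ := g2.sub (iWxy.const_mul _)
  have g4 : Integrable (fun ω => (μ[fun a => X a * Y a * Z a|m]) ω
      - (∫ a, X a ∂μ) * (μ[fun a => Y a * Z a|m]) ω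
      - (∫ a, Y a ∂μ) * (μ[fun a => X a * Z a|m]) ω
      - (∫ a, Z a ∂μ) * (μ[fun a => X a * Y a|m]) ω
      + (∫ a, X a ∂μ) * (∫ a, Y a ∂μ) * (μ[Z|m]) ω) μ := g3.add (iZh.const_mul _)
  have g5 : Integrable (fun ω => (μ[fun a => X a * Y a * Z a|m]) ω
      - (∫ a, X a ∂μ) * (μ[fun a => Y a * Z a|m]) ω
      - (∫ a, Y a ∂μ) * (μ[fun a => X a * Z a|m]) ω
      - (∫ a, Z a ∂μ) * (μ[fun a => X a * Y a|m]) ω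
      + (∫ a, X a ∂μ) * (∫ a, Y a ∂μ) * (μ[Z|m]) ω
      + (∫ a, X a ∂μ) * (∫ a, Z a ∂μ) * (μ[Y|m]) ω) μ := g4.add (iYh.const_mul _)
  have g6 : Integrable (fun ω => (μ[fun a => X a * Y a * Z a|m]) ω
      - (∫ a, X a ∂μ) * (μ[fun a => Y a * Z a|m]) ω
      - (∫ a, Y a ∂μ) * (μ[fun a => X a * Z a|m]) ω
      - (∫ a, Z a ∂μ) * (μ[fun a => X a * Y a|m]) ω
      + (∫ a, X a ∂μ) * (∫ a, Y a ∂μ) * (μ[Z|m]) ω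
      + (∫ a, X a ∂μ) * (∫ a, Z a ∂μ) * (μ[Y|m]) ω
      + (∫ a, Y a ∂μ) * (∫ a, Z a ∂μ) * (μ[X|m]) ω) μ := g5.add (iXh.const_mul _)
  rw [integral_sub g6 (integrable_const _), integral_add g5 (iXh.const_mul _),
    integral_add g4 (iYh.const_mul _), integral_add g3 (iZh.const_mul _),
    integral_sub g2 (iWxy.const_mul _), integral_sub g1 (iWxz.const_mul _),
    integral_sub iWxyz (iWyz.const_mul _)]
  simp only [integral_const_mul, integral_const, probReal_univ, one_smul, integral_condExp hm]
  -- Step 4: expand the left-hand side the same way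
  have hl : ∀ ω, (X ω - ∫ a, X a ∂μ) * (Y ω - ∫ a, Y a ∂μ) * (Z ω - ∫ a, Z a ∂μ)
      = X ω * Y ω * Z ω - (∫ a, X a ∂μ) * (Y ω * Z ω) - (∫ a, Y a ∂μ) * (X ω * Z ω)
        - (∫ a, Z a ∂μ) * (X ω * Y ω)
        + (∫ a, X a ∂μ) * (∫ a, Y a ∂μ) * Z ω + (∫ a, X a ∂μ) * (∫ a, Z a ∂μ) * Y ω
        + (∫ a, Y a ∂μ) * (∫ a, Z a ∂μ) * X ω
        - (∫ a, X a ∂μ) * (∫ a, Y a ∂μ) * (∫ a, Z a ∂μ) := fun ω => by ring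
  simp only [cum3]
  simp_rw [hl]
  have f1 : Integrable (fun ω => X ω * Y ω * Z ω - (∫ a, X a ∂μ) * (Y ω * Z ω)) μ :=
    iXYZ.sub (iYZ.const_mul _)
  have f2 : Integrable (fun ω => X ω * Y ω * Z ω - (∫ a, X a ∂μ) * (Y ω * Z ω)
      - (∫ a, Y a ∂μ) * (X ω * Z ω)) μ := f1.sub (iXZ.const_mul _)
  have f3 : Integrable (fun ω => X ω * Y ω * Z ω - (∫ a, X a ∂μ) * (Y ω * Z ω)
      - (∫ a, Y a ∂μ) * (X ω * Z ω) - (∫ a, Z a ∂μ) * (X ω * Y ω)) μ := f2.sub (iXY.const_mul _)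
  have f4 : Integrable (fun ω => X ω * Y ω * Z ω - (∫ a, X a ∂μ) * (Y ω * Z ω)
      - (∫ a, Y a ∂μ) * (X ω * Z ω) - (∫ a, Z a ∂μ) * (X ω * Y ω)
      + (∫ a, X a ∂μ) * (∫ a, Y a ∂μ) * Z ω) μ := f3.add (iZ.const_mul _)
  have f5 : Integrable (fun ω => X ω * Y ω * Z ω - (∫ a, X a ∂μ) * (Y ω * Z ω)
      - (∫ a, Y a ∂μ) * (X ω * Z ω) - (∫ a, Z a ∂μ) * (X ω * Y ω)
      + (∫ a, X a ∂μ) * (∫ a, Y a ∂μ) * Z ω + (∫ a, X a ∂μ) * (∫ a, Z a ∂μ) * Y ω) μ :=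
    f4.add (iY.const_mul _)
  have f6 : Integrable (fun ω => X ω * Y ω * Z ω - (∫ a, X a ∂μ) * (Y ω * Z ω)
      - (∫ a, Y a ∂μ) * (X ω * Z ω) - (∫ a, Z a ∂μ) * (X ω * Y ω)
      + (∫ a, X a ∂μ) * (∫ a, Y a ∂μ) * Z ω + (∫ a, X a ∂μ) * (∫ a, Z a ∂μ) * Y ω
      + (∫ a, Y a ∂μ) * (∫ a, Z a ∂μ) * X ω) μ := f5.add (iX.const_mul _)
  rw [integral_sub f6 (integrable_const _), integral_add f5 (iX.const_mul _),
    integral_add f4 (iY.const_mul _), integral_add f3 (iZ.const_mul _),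
    integral_sub f2 (iXY.const_mul _), integral_sub f1 (iXZ.const_mul _),
    integral_sub iXYZ (iYZ.const_mul _)]
  simp only [integral_const_mul, integral_const, probReal_univ, one_smul]

end TotalCumulance

section DirichletWindow

open Literature.MathematicalPhysics.QuantumLattice
open Literature.Probability.LatticeModels (Site box)

variable {G : Type} [Group G] [TopologicalSpace G] [IsTopologicalGroup G] [CompactSpace G]
  [MeasurableSpace G] [BorelSpace G]

/-- The crux's plaquette field on `ℤ⁴` configurations: `P_x = N − Re tr r(U_{x;0,1})`. -/
def plaqZd (r : LatticeRep G) (x : Site 4) (U : LGConfig 4 G) : ℝ :=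
  (r.N : ℝ) - plaquetteObs r.ρ x 0 1 U

/-- **C⁺ of card `dirichlet-window-skewness` (the inner lemma, modelled on route DirichletWindow's
`BoxLaplace`): Dirichlet Laplace lemma for the SKEWNESS at the centre of a mesoscopic window.**
With `Λ` = the edges based in `{−L..L}⁴`, `L = ⌈β^θ⌉`, `good` = every plaquette touching `Λ` has
`P ≤ β^{-15/16}`, `ν_ω` = Wilson's DLR kernel conditioned on `good`, and `D_y(ω)` the conditional
excess action at the (0,1)-plaquette at `y` (all exactly as in `DirichletWindow.BoxLaplace`): for
every boundary condition `ω` giving `good` probability `≥ 1/2`, the conditional third cumulant of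
`(P₀, P_{ne₂}, P_{ne₃})` under `ν_ω` is bounded BELOW by the Dirichlet permanental triangle minus
background-controlled terms:
`A/(β³n¹²) − C·S/(β²n⁸) − C·S²/(βn⁴) − C·S³ − C/β^{3+δ'} ≤ κ₃^{ν_ω}`, `S = D₀⁺ + D₂⁺ + D₃⁺`.
(The card argues the `S`-terms are in fact non-negative dressings at leading order, so only their
`o(1)` corrections are unsigned; the statement keeps the conservative form.) -/
def DirichletSkewLaplace : Prop :=
  ∀ (G : Type) [Group G] [TopologicalSpace G] [IsTopologicalGroup G] [CompactSpace G]
    [MeasurableSpace G] [BorelSpace G], IsCompactSimpleLieGroup G → ∀ r : LatticeRep G,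
    ∃ θ A C δ' : ℝ, ∃ n₀ : ℕ, 0 < θ ∧ θ ≤ 1 / 16 ∧ 0 < A ∧ 0 < δ' ∧ ∀ n : ℕ, n₀ ≤ n →
      ∃ β₁ : ℝ, ∀ β : ℝ, β₁ ≤ β →
        let Λ : Finset (Literature.MathematicalPhysics.QuantumLattice.ZdEdge 4) := box 4 ⌈β ^ θ⌉₊ ×ˢ (Finset.univ : Finset (Fin 4))
        let good : Set (LGConfig 4 G) :=
          {U | ∀ p ∈ plaquettesTouching Λ,
            (r.N : ℝ) - plaquetteObs r.ρ p.1 p.2.1.1 p.2.1.2 U ≤ β ^ (-(15 : ℝ) / 16)}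
        let ν : LGConfig 4 G → Measure (LGConfig 4 G) :=
          fun η => ProbabilityTheory.cond (ymSpecification r.ρ β Λ η) good
        let D : Site 4 → LGConfig 4 G → ℝ :=
          fun y η => (∫ U, plaqZd r y U ∂(ν η)) - ∫ U, plaqZd r y U ∂(ν 1)
        let y : Site 4 := (n : ℤ) • Pi.single (2 : Fin 4) (1 : ℤ)
        let z : Site 4 := (n : ℤ) • Pi.single (3 : Fin 4) (1 : ℤ)
        ∀ ω : LGConfig 4 G, (2⁻¹ : ENNReal) ≤ ymSpecification r.ρ β Λ ω good →
          let S : ℝ := max (D 0 ω) 0 + max (D y ω) 0 + max (D z ω) 0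
          A / (β ^ 3 * (n : ℝ) ^ 12) - C * S / (β ^ 2 * (n : ℝ) ^ 8) - C * S ^ 2 / (β * (n : ℝ) ^ 4)
              - C * S ^ 3 - C / β ^ (3 + δ')
            ≤ cum3 (ν ω) (plaqZd r 0) (plaqZd r y) (plaqZd r z)

/-- **Output of the window on LARGE tori** (what B1 + `DirichletSkewLaplace` + the equipartition
budget of `DirichletWindow.BackgroundBudget` (with third moments `E[D³] ≤ δ/β³` added) deliver,
read back on the crux's own tori through the DLR kernel of a window that fits, `L ≥ 2⌈β^θ⌉ + 3`):
for each fixed separation `n₀ ≤ n ≤ n₁`, a volume-uniform lower bound `A'/(β³n¹²) ≤ κ₃(L, β, n)`. -/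
def LargeTorusSkewness (r : LatticeRep G) (n₀ n₁ : ℕ) : Prop :=
  ∃ θ : ℝ, 0 < θ ∧ ∀ n : ℕ, n₀ ≤ n → n ≤ n₁ → ∃ A' β₁ : ℝ, 0 < A' ∧ ∀ β : ℝ, β₁ ≤ β →
    ∀ (L : ℕ) [NeZero L], 2 * ⌈β ^ θ⌉₊ + 3 ≤ L → A' / (β ^ 3 * (n : ℝ) ^ 12) ≤ kappa3 r L β n

/-- **Complementary SMALL-torus regime** (fixed-torus Laplace with torons, card
`toron-resolved-corner`'s `FixedTorusSkewnessLimit`, needed only for the finitely many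
`8n ≤ L < 2⌈β^θ⌉ + 3`, i.e. `β > ((L−3)/2)^{1/θ} ≫ L⁴ log L` — inside its Laplace regime). -/
def SmallTorusSkewness (r : LatticeRep G) (n₀ n₁ : ℕ) : Prop :=
  ∃ θ : ℝ, 0 < θ ∧ ∀ n : ℕ, n₀ ≤ n → n ≤ n₁ → ∃ A' β₁ : ℝ, 0 < A' ∧ ∀ β : ℝ, β₁ ≤ β →
    ∀ (L : ℕ) [NeZero L], 8 * n ≤ L → L < 2 * ⌈β ^ θ⌉₊ + 3 →
      A' / (β ^ 3 * (n : ℝ) ^ 12) ≤ kappa3 r L β n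

/-- **The artefact layer of the crux, for EVERY unit map**: at each fixed separation
`n₀ ≤ n ≤ n₁`, a lower bound `A'/(β³n¹²) ≤ κ₃(L,β,n)` on ALL tori `L ≥ 8n` at weak coupling —
no relation between `L` and `β` assumed. -/
def ArtefactLayerSkewness (r : LatticeRep G) (n₀ n₁ : ℕ) : Prop :=
  ∀ n : ℕ, n₀ ≤ n → n ≤ n₁ → ∃ A' β₁ : ℝ, 0 < A' ∧ ∀ β : ℝ, β₁ ≤ β →
    ∀ (L : ℕ) [NeZero L], 8 * n ≤ L → A' / (β ^ 3 * (n : ℝ) ^ 12) ≤ kappa3 r L β n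

/-- Glue (proved): the two regimes with a COMMON exponent `θ` cover every torus `L ≥ 8n`. -/
theorem artefactLayer_of_small_large (r : LatticeRep G) (n₀ n₁ : ℕ) (hn₀ : 1 ≤ n₀) (θ : ℝ)
    (hS : ∀ n : ℕ, n₀ ≤ n → n ≤ n₁ → ∃ A' β₁ : ℝ, 0 < A' ∧ ∀ β : ℝ, β₁ ≤ β →
      ∀ (L : ℕ) [NeZero L], 8 * n ≤ L → L < 2 * ⌈β ^ θ⌉₊ + 3 →
        A' / (β ^ 3 * (n : ℝ) ^ 12) ≤ kappa3 r L β n)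
    (hL : ∀ n : ℕ, n₀ ≤ n → n ≤ n₁ → ∃ A' β₁ : ℝ, 0 < A' ∧ ∀ β : ℝ, β₁ ≤ β →
      ∀ (L : ℕ) [NeZero L], 2 * ⌈β ^ θ⌉₊ + 3 ≤ L → A' / (β ^ 3 * (n : ℝ) ^ 12) ≤ kappa3 r L β n) :
    ArtefactLayerSkewness r n₀ n₁ := by
  intro n hn₀' hn₁
  obtain ⟨A₁, b₁, hA₁, h₁⟩ := hS n hn₀' hn₁
  obtain ⟨A₂, b₂, hA₂, h₂⟩ := hL n hn₀' hn₁
  refine ⟨min A₁ A₂, max (max b₁ b₂) 1, lt_min hA₁ hA₂, fun β hβ L _ h8 => ?_⟩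
  have hβ₁ : b₁ ≤ β := le_trans (le_trans (le_max_left _ _) (le_max_left _ _)) hβ
  have hβ₂ : b₂ ≤ β := le_trans (le_trans (le_max_right _ _) (le_max_left _ _)) hβ
  have hβpos : 0 < β := lt_of_lt_of_le one_pos (le_trans (le_max_right _ _) hβ)
  have hn : (1 : ℝ) ≤ n := by exact_mod_cast (le_trans hn₀ hn₀')
  have hden : 0 < β ^ 3 * (n : ℝ) ^ 12 := by positivity
  rcases Nat.lt_or_ge L (2 * ⌈β ^ θ⌉₊ + 3) with hlt | hge
  · calc min A₁ A₂ / (β ^ 3 * (n : ℝ) ^ 12) ≤ A₁ / (β ^ 3 * (n : ℝ) ^ 12) :=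
          div_le_div_of_nonneg_right (min_le_left _ _) hden.le
      _ ≤ kappa3 r L β n := h₁ β hβ₁ L h8 hlt
  · calc min A₁ A₂ / (β ^ 3 * (n : ℝ) ^ 12) ≤ A₂ / (β ^ 3 * (n : ℝ) ^ 12) :=
          div_le_div_of_nonneg_right (min_le_right _ _) hden.le
      _ ≤ kappa3 r L β n := h₂ β hβ₂ L hge

/-- **How the artefact layer feeds the crux's conclusion (proved bookkeeping):** on the separations
`1 ≤ n ≤ n₁` the crux's inequality holds for EVERY unit map `a` with the `a`-free shape
`Γ₃(s) := 1` restricted to... — precisely: for any `a > 0`, any `β ≥ β₁(n₁)` and any torus in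
`a`'s femto range, `c₃ ≤ n¹²|κ₃|·β³/A'`; i.e. the layer supplies the lattice-artefact constants that
every engine line (`skeleton-ratio`, `wick-triangle-ratio`, `permanental-rigidity`, …) takes as
given for `n ≤ n₀`, now with `L`-uniformity included.  Stated here in the simplest usable form. -/
theorem skewness_on_artefact_layer (r : LatticeRep G) {n₁ : ℕ}
    (h : ArtefactLayerSkewness r 1 n₁) :
    ∀ n : ℕ, 1 ≤ n → n ≤ n₁ → ∃ A' β₁ : ℝ, 0 < A' ∧ ∀ β : ℝ, β₁ ≤ β →
      ∀ (L : ℕ) [NeZero L], 8 * n ≤ L → A' / β ^ 3 ≤ (n : ℝ) ^ 12 * |kappa3 r L β n| := by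
  intro n hn hn₁
  obtain ⟨A', β₁, hA', hb⟩ := h n hn hn₁
  refine ⟨A', max β₁ 1, hA', fun β hβ L _ h8 => ?_⟩
  have hβ₁ : β₁ ≤ β := le_trans (le_max_left _ _) hβ
  have hβpos : 0 < β := lt_of_lt_of_le one_pos (le_trans (le_max_right _ _) hβ)
  have hnpos : (0 : ℝ) < (n : ℝ) ^ 12 := by
    have : (1 : ℝ) ≤ n := by exact_mod_cast hn
    positivity
  have key := hb β hβ₁ L h8
  have hn0 : (n : ℝ) ^ 12 ≠ 0 := hnpos.ne'
  have h1 : A' / β ^ 3 = A' / (β ^ 3 * (n : ℝ) ^ 12) * (n : ℝ) ^ 12 := by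
    field_simp
  rw [h1]
  calc A' / (β ^ 3 * (n : ℝ) ^ 12) * (n : ℝ) ^ 12 ≤ kappa3 r L β n * (n : ℝ) ^ 12 :=
        mul_le_mul_of_nonneg_right key hnpos.le
    _ ≤ |kappa3 r L β n| * (n : ℝ) ^ 12 := mul_le_mul_of_nonneg_right (le_abs_self _) hnpos.le
    _ = (n : ℝ) ^ 12 * |kappa3 r L β n| := mul_comm _ _

end DirichletWindow

end Summit.QuantumFields.YangMills.Cruxes.FemtoCurvatureSkewness.SketchG2I1
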